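import Summits.AtomisticToContinuum.HydrodynamicLimit.Theorems.ImplosionDichotomyPolynomialCompressionUniquenessIdentity
import Summits.AtomisticToContinuum.HydrodynamicLimit.Theorems.ImplosionDichotomyPolynomialCompressionShadowingDefs
import Literature.Analysis.FunctionSpaces.TorusSupNormContinuity

/-!
# Regularity of the shadowing level energies (line `log-lipschitz-budget`, stub 4)

Helper file for the line `log-lipschitz-budget` of the crux
`ImplosionDichotomy.PolynomialCompression` (stub `stub_logBudgetShadowing`, blueprint §5 CLOSE).
A σ-solution `(ρ, u, θ)` of the hard-sphere Euler system with pressure law `ρ θ ζ(ρ)` (`ζ` smooth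
on an open set `J` containing the densities) is compared with a reference solution `(ρ₁, u₁, θ₁)`
(an `IsHardSphereEulerSolution σ₁ T ρ₁ u₁ θ₁`, any `σ₁`); the difference `(δρ, δu, δθ)` is measured
by the weighted level-`k` energies `E_k(s) = ∫ e_k(s, x) dx` (`shadowE0 … shadowE3` of
`…ShadowingDefs`) with densities `e_k = Σ_{|α| = k} ½ (A (∂^α δρ)² + ρ ‖∂^α δu‖² + B (∂^α δθ)²)`
(ordered multi-indices, outermost derivative = outermost sum) and the Friedrichs weights
`A = θ (ζ(ρ) + ρ ζ'(ρ)) / ρ = shadowWeightA`, `B = 3ρ/(2θ) = shadowWeightB` of the σ-solution.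

The file supplies the regularity inputs of the Grönwall shell (`torus_energy_le_of_balance`) and
of the closing continuity (bootstrap) argument:

* `isSmoothSpaceTimeOn_shadowDensity0 … 3` (weights inline) and
  `isSmoothSpaceTimeOn_shadowE0_integrand … E3_integrand` (literally the bodies of `shadowE_k`) —
  the densities `e_k` are jointly smooth on `[0, T) × 𝕋³` (algebra of jointly smooth fields and
  `Torus.IsSmoothSpaceTimeOn.partialDeriv` on the time set `Ico 0 T` of unique differentiability);
  `isSmoothSpaceTimeOn_shadowWeightA/B` — the named weights are jointly smooth;
* `continuousOn_shadowE0 … 3` — `shadowE_k …` is continuous on `[0, T)`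
  (`Torus.IsSmoothSpaceTimeOn.continuousOn_integral`);
* `shadow_sup_continuous` (scalar) / `shadow_sup_continuous_vec` (`V3`-valued) — for a jointly
  smooth field `φ` on `[0, T) × 𝕋³` the sup norm `s ↦ (eSupNorm (φ s)).toReal` is continuous on
  `[0, T)`, dominates `|φ s x|`, and is below every pointwise bound `M ≥ 0` (re-export of
  `Torus.IsSmoothSpaceTimeOn.continuousOn_toReal_eSupNorm`, `Torus.norm_le_toReal_eSupNorm`).

All bridges between the inline and the named spellings are definitional (`exact` closes them).
-/

noncomputable section

namespace Summit.AtomisticToContinuum.HydrodynamicLimit.Theorems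

open Set Filter Topology MeasureTheory
open scoped ContDiff ENNReal
open Literature.MathematicalPhysics.KineticTheory Literature.Analysis.FunctionSpaces

/-! ### Algebra of jointly smooth fields (squares, norm squares, the generic energy term) -/

section Algebra

variable {S : Set ℝ}

/-- Squares of jointly smooth scalar fields are jointly smooth. [folklore] -/
theorem isSmoothSpaceTimeOn_sq {φ : ℝ → T3 → ℝ} (h : Torus.IsSmoothSpaceTimeOn S φ) :
    Torus.IsSmoothSpaceTimeOn S (fun s x => φ s x ^ 2) :=
  ContDiffOn.pow h 2

/-- Norm squares of jointly smooth `V3`-valued fields are jointly smooth. [folklore] -/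
theorem isSmoothSpaceTimeOn_norm_sq {w : ℝ → T3 → V3} (h : Torus.IsSmoothSpaceTimeOn S w) :
    Torus.IsSmoothSpaceTimeOn S (fun s x => ‖w s x‖ ^ 2) :=
  ContDiffOn.norm_sq ℝ h

/-- Constant multiples of jointly smooth scalar fields are jointly smooth. [folklore] -/
theorem isSmoothSpaceTimeOn_const_mul {φ : ℝ → T3 → ℝ} (h : Torus.IsSmoothSpaceTimeOn S φ)
    (c : ℝ) : Torus.IsSmoothSpaceTimeOn S (fun s x => c * φ s x) :=
  contDiffOn_const.mul h

/-- The generic level-energy term `½ (A X² + P ‖W‖² + B Y²)` is jointly smooth when the weights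
`A, P, B`, the scalar entries `X, Y` and the vector entry `W` are. [folklore] -/
theorem isSmoothSpaceTimeOn_energyTerm {A P B X Y : ℝ → T3 → ℝ} {W : ℝ → T3 → V3}
    (hA : Torus.IsSmoothSpaceTimeOn S A) (hP : Torus.IsSmoothSpaceTimeOn S P)
    (hB : Torus.IsSmoothSpaceTimeOn S B) (hX : Torus.IsSmoothSpaceTimeOn S X)
    (hW : Torus.IsSmoothSpaceTimeOn S W) (hY : Torus.IsSmoothSpaceTimeOn S Y) :
    Torus.IsSmoothSpaceTimeOn S
      (fun s x => 1 / 2 * (A s x * X s x ^ 2 + P s x * ‖W s x‖ ^ 2 + B s x * Y s x ^ 2)) :=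
  isSmoothSpaceTimeOn_const_mul
    (((hA.mul (isSmoothSpaceTimeOn_sq hX)).add (hP.mul (isSmoothSpaceTimeOn_norm_sq hW))).add
      (hB.mul (isSmoothSpaceTimeOn_sq hY))) _

end Algebra

/-! ### Joint smoothness of the level densities -/

section Densities

/-- **Level 0.** The density `e₀ = ½ (A δρ² + ρ ‖δu‖² + B δθ²)` of `shadowE0` is jointly smooth on
`[0, T) × 𝕋³`. [folklore] -/
theorem isSmoothSpaceTimeOn_shadowDensity0 :
    ∀ {σ σ₁ T : ℝ} {ρ θ ρ₁ θ₁ : ℝ → T3 → ℝ} {u u₁ : ℝ → T3 → V3} {ζ : ℝ → ℝ} {J : Set ℝ},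
    IsHardSphereEulerSolution σ T ρ u θ → IsHardSphereEulerSolution σ₁ T ρ₁ u₁ θ₁ → IsOpen J →
    ContDiffOn ℝ (⊤ : ℕ∞) ζ J → (∀ t ∈ Ico 0 T, ∀ x, ρ t x ∈ J) →
    Torus.IsSmoothSpaceTimeOn (Ico 0 T) (fun s x => 1 / 2 *
      (θ s x * (ζ (ρ s x) + ρ s x * deriv ζ (ρ s x)) / ρ s x * (ρ s x - ρ₁ s x) ^ 2 +
        ρ s x * ‖u s x - u₁ s x‖ ^ 2 + 3 / 2 * ρ s x / θ s x * (θ s x - θ₁ s x) ^ 2)) := by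
  intro σ σ₁ T ρ θ ρ₁ θ₁ u u₁ ζ J hE hE₁ hJ hζ hρJ
  exact isSmoothSpaceTimeOn_energyTerm (isSmoothSpaceTimeOn_weightA hE hJ hζ hρJ) hE.smooth_density
    (isSmoothSpaceTimeOn_weightB hE) (hE.smooth_density.sub hE₁.smooth_density)
    (hE.smooth_velocity.sub hE₁.smooth_velocity) (hE.smooth_temperature.sub hE₁.smooth_temperature)

/-- **Level 1.** The density `e₁ = Σₗ ½ (A (∂ₗδρ)² + ρ ‖∂ₗδu‖² + B (∂ₗδθ)²)` of `shadowE1` is jointly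
smooth on `[0, T) × 𝕋³`. [folklore] -/
theorem isSmoothSpaceTimeOn_shadowDensity1 :
    ∀ {σ σ₁ T : ℝ} {ρ θ ρ₁ θ₁ : ℝ → T3 → ℝ} {u u₁ : ℝ → T3 → V3} {ζ : ℝ → ℝ} {J : Set ℝ},
    IsHardSphereEulerSolution σ T ρ u θ → IsHardSphereEulerSolution σ₁ T ρ₁ u₁ θ₁ → IsOpen J →
    ContDiffOn ℝ (⊤ : ℕ∞) ζ J → (∀ t ∈ Ico 0 T, ∀ x, ρ t x ∈ J) →
    Torus.IsSmoothSpaceTimeOn (Ico 0 T) (fun s x => ∑ l : Fin 3, 1 / 2 *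
      (θ s x * (ζ (ρ s x) + ρ s x * deriv ζ (ρ s x)) / ρ s x *
          (Torus.partialDeriv l (fun y => ρ s y - ρ₁ s y) x) ^ 2 +
        ρ s x * ‖Torus.partialDeriv l (fun y => u s y - u₁ s y) x‖ ^ 2 +
        3 / 2 * ρ s x / θ s x * (Torus.partialDeriv l (fun y => θ s y - θ₁ s y) x) ^ 2)) := by
  intro σ σ₁ T ρ θ ρ₁ θ₁ u u₁ ζ J hE hE₁ hJ hζ hρJ
  have hU : UniqueDiffOn ℝ (Ico (0 : ℝ) T) := uniqueDiffOn_Ico 0 T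
  refine Torus.IsSmoothSpaceTimeOn.sum fun l _ => ?_
  exact isSmoothSpaceTimeOn_energyTerm (isSmoothSpaceTimeOn_weightA hE hJ hζ hρJ) hE.smooth_density
    (isSmoothSpaceTimeOn_weightB hE) ((hE.smooth_density.sub hE₁.smooth_density).partialDeriv hU l)
    ((hE.smooth_velocity.sub hE₁.smooth_velocity).partialDeriv hU l)
    ((hE.smooth_temperature.sub hE₁.smooth_temperature).partialDeriv hU l)

/-- **Level 2.** The density `e₂ = Σᵢ Σₗ ½ (A (∂ᵢ∂ₗδρ)² + ρ ‖∂ᵢ∂ₗδu‖² + B (∂ᵢ∂ₗδθ)²)` of `shadowE2`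
is jointly smooth on `[0, T) × 𝕋³`. [folklore] -/
theorem isSmoothSpaceTimeOn_shadowDensity2 :
    ∀ {σ σ₁ T : ℝ} {ρ θ ρ₁ θ₁ : ℝ → T3 → ℝ} {u u₁ : ℝ → T3 → V3} {ζ : ℝ → ℝ} {J : Set ℝ},
    IsHardSphereEulerSolution σ T ρ u θ → IsHardSphereEulerSolution σ₁ T ρ₁ u₁ θ₁ → IsOpen J →
    ContDiffOn ℝ (⊤ : ℕ∞) ζ J → (∀ t ∈ Ico 0 T, ∀ x, ρ t x ∈ J) →
    Torus.IsSmoothSpaceTimeOn (Ico 0 T) (fun s x => ∑ i : Fin 3, ∑ l : Fin 3, 1 / 2 *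
      (θ s x * (ζ (ρ s x) + ρ s x * deriv ζ (ρ s x)) / ρ s x *
          (Torus.partialDeriv i (Torus.partialDeriv l (fun y => ρ s y - ρ₁ s y)) x) ^ 2 +
        ρ s x * ‖Torus.partialDeriv i (Torus.partialDeriv l (fun y => u s y - u₁ s y)) x‖ ^ 2 +
        3 / 2 * ρ s x / θ s x *
          (Torus.partialDeriv i (Torus.partialDeriv l (fun y => θ s y - θ₁ s y)) x) ^ 2)) := by
  intro σ σ₁ T ρ θ ρ₁ θ₁ u u₁ ζ J hE hE₁ hJ hζ hρJ
  have hU : UniqueDiffOn ℝ (Ico (0 : ℝ) T) := uniqueDiffOn_Ico 0 T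
  refine Torus.IsSmoothSpaceTimeOn.sum fun i _ => Torus.IsSmoothSpaceTimeOn.sum fun l _ => ?_
  exact isSmoothSpaceTimeOn_energyTerm (isSmoothSpaceTimeOn_weightA hE hJ hζ hρJ) hE.smooth_density
    (isSmoothSpaceTimeOn_weightB hE)
    (((hE.smooth_density.sub hE₁.smooth_density).partialDeriv hU l).partialDeriv hU i)
    (((hE.smooth_velocity.sub hE₁.smooth_velocity).partialDeriv hU l).partialDeriv hU i)
    (((hE.smooth_temperature.sub hE₁.smooth_temperature).partialDeriv hU l).partialDeriv hU i)

/-- **Level 3.** The density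
`e₃ = Σⱼ Σᵢ Σₗ ½ (A (∂ⱼ∂ᵢ∂ₗδρ)² + ρ ‖∂ⱼ∂ᵢ∂ₗδu‖² + B (∂ⱼ∂ᵢ∂ₗδθ)²)` of `shadowE3` is jointly smooth
on `[0, T) × 𝕋³`. [folklore] -/
theorem isSmoothSpaceTimeOn_shadowDensity3 :
    ∀ {σ σ₁ T : ℝ} {ρ θ ρ₁ θ₁ : ℝ → T3 → ℝ} {u u₁ : ℝ → T3 → V3} {ζ : ℝ → ℝ} {J : Set ℝ},
    IsHardSphereEulerSolution σ T ρ u θ → IsHardSphereEulerSolution σ₁ T ρ₁ u₁ θ₁ → IsOpen J →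
    ContDiffOn ℝ (⊤ : ℕ∞) ζ J → (∀ t ∈ Ico 0 T, ∀ x, ρ t x ∈ J) →
    Torus.IsSmoothSpaceTimeOn (Ico 0 T) (fun s x => ∑ j : Fin 3, ∑ i : Fin 3, ∑ l : Fin 3, 1 / 2 *
      (θ s x * (ζ (ρ s x) + ρ s x * deriv ζ (ρ s x)) / ρ s x *
          (Torus.partialDeriv j (Torus.partialDeriv i (Torus.partialDeriv l
            (fun y => ρ s y - ρ₁ s y))) x) ^ 2 +
        ρ s x * ‖Torus.partialDeriv j (Torus.partialDeriv i (Torus.partialDeriv l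
            (fun y => u s y - u₁ s y))) x‖ ^ 2 +
        3 / 2 * ρ s x / θ s x *
          (Torus.partialDeriv j (Torus.partialDeriv i (Torus.partialDeriv l
            (fun y => θ s y - θ₁ s y))) x) ^ 2)) := by
  intro σ σ₁ T ρ θ ρ₁ θ₁ u u₁ ζ J hE hE₁ hJ hζ hρJ
  have hU : UniqueDiffOn ℝ (Ico (0 : ℝ) T) := uniqueDiffOn_Ico 0 T
  refine Torus.IsSmoothSpaceTimeOn.sum fun j _ => Torus.IsSmoothSpaceTimeOn.sum fun i _ =>
    Torus.IsSmoothSpaceTimeOn.sum fun l _ => ?_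
  exact isSmoothSpaceTimeOn_energyTerm (isSmoothSpaceTimeOn_weightA hE hJ hζ hρJ) hE.smooth_density
    (isSmoothSpaceTimeOn_weightB hE)
    ((((hE.smooth_density.sub hE₁.smooth_density).partialDeriv hU l).partialDeriv hU i).partialDeriv
      hU j)
    ((((hE.smooth_velocity.sub hE₁.smooth_velocity).partialDeriv hU l).partialDeriv hU
      i).partialDeriv hU j)
    ((((hE.smooth_temperature.sub hE₁.smooth_temperature).partialDeriv hU l).partialDeriv hU
      i).partialDeriv hU j)

end Densities

/-! ### The same, over the vocabulary of `…ShadowingDefs` (`shadowWeightA/B`, bodies of `shadowE_k`) -/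

section Vocabulary

/-- The weight `shadowWeightA ζ ρ θ = θ (ζ(ρ) + ρ ζ'(ρ)) / ρ` of a σ-solution is jointly smooth on
`[0, T) × 𝕋³` (`isSmoothSpaceTimeOn_weightA`, named form). [folklore] -/
theorem isSmoothSpaceTimeOn_shadowWeightA :
    ∀ {σ T : ℝ} {ρ θ : ℝ → T3 → ℝ} {u : ℝ → T3 → V3} {ζ : ℝ → ℝ} {J : Set ℝ},
    IsHardSphereEulerSolution σ T ρ u θ → IsOpen J → ContDiffOn ℝ (⊤ : ℕ∞) ζ J →
    (∀ t ∈ Ico 0 T, ∀ x, ρ t x ∈ J) → Torus.IsSmoothSpaceTimeOn (Ico 0 T) (shadowWeightA ζ ρ θ) :=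
  fun hE hJ hζ hρJ => isSmoothSpaceTimeOn_weightA hE hJ hζ hρJ

/-- The weight `shadowWeightB ρ θ = 3ρ/(2θ)` of a σ-solution is jointly smooth on `[0, T) × 𝕋³`
(`isSmoothSpaceTimeOn_weightB`, named form). [folklore] -/
theorem isSmoothSpaceTimeOn_shadowWeightB :
    ∀ {σ T : ℝ} {ρ θ : ℝ → T3 → ℝ} {u : ℝ → T3 → V3},
    IsHardSphereEulerSolution σ T ρ u θ → Torus.IsSmoothSpaceTimeOn (Ico 0 T) (shadowWeightB ρ θ) :=
  fun hE => isSmoothSpaceTimeOn_weightB hE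

/-- **Level 0, integrand of `shadowE0`** (literally its body): jointly smooth on `[0, T) × 𝕋³`.
[folklore] -/
theorem isSmoothSpaceTimeOn_shadowE0_integrand :
    ∀ {σ σ₁ T : ℝ} {ρ θ ρ₁ θ₁ : ℝ → T3 → ℝ} {u u₁ : ℝ → T3 → V3} {ζ : ℝ → ℝ} {J : Set ℝ},
    IsHardSphereEulerSolution σ T ρ u θ → IsHardSphereEulerSolution σ₁ T ρ₁ u₁ θ₁ → IsOpen J →
    ContDiffOn ℝ (⊤ : ℕ∞) ζ J → (∀ t ∈ Ico 0 T, ∀ x, ρ t x ∈ J) →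
    Torus.IsSmoothSpaceTimeOn (Ico 0 T) (fun s x => 1 / 2 *
      (shadowWeightA ζ ρ θ s x * (ρ s x - ρ₁ s x) ^ 2 + ρ s x * ‖u s x - u₁ s x‖ ^ 2 +
        shadowWeightB ρ θ s x * (θ s x - θ₁ s x) ^ 2)) :=
  fun hE hE₁ hJ hζ hρJ => isSmoothSpaceTimeOn_shadowDensity0 hE hE₁ hJ hζ hρJ

/-- **Level 1, integrand of `shadowE1`** (literally its body): jointly smooth on `[0, T) × 𝕋³`.
[folklore] -/
theorem isSmoothSpaceTimeOn_shadowE1_integrand :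
    ∀ {σ σ₁ T : ℝ} {ρ θ ρ₁ θ₁ : ℝ → T3 → ℝ} {u u₁ : ℝ → T3 → V3} {ζ : ℝ → ℝ} {J : Set ℝ},
    IsHardSphereEulerSolution σ T ρ u θ → IsHardSphereEulerSolution σ₁ T ρ₁ u₁ θ₁ → IsOpen J →
    ContDiffOn ℝ (⊤ : ℕ∞) ζ J → (∀ t ∈ Ico 0 T, ∀ x, ρ t x ∈ J) →
    Torus.IsSmoothSpaceTimeOn (Ico 0 T) (fun s x => ∑ l : Fin 3, 1 / 2 *
      (shadowWeightA ζ ρ θ s x * (Torus.partialDeriv l (fun y => ρ s y - ρ₁ s y) x) ^ 2 +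
        ρ s x * ‖Torus.partialDeriv l (fun y => u s y - u₁ s y) x‖ ^ 2 +
        shadowWeightB ρ θ s x * (Torus.partialDeriv l (fun y => θ s y - θ₁ s y) x) ^ 2)) :=
  fun hE hE₁ hJ hζ hρJ => isSmoothSpaceTimeOn_shadowDensity1 hE hE₁ hJ hζ hρJ

/-- **Level 2, integrand of `shadowE2`** (literally its body): jointly smooth on `[0, T) × 𝕋³`.
[folklore] -/
theorem isSmoothSpaceTimeOn_shadowE2_integrand :
    ∀ {σ σ₁ T : ℝ} {ρ θ ρ₁ θ₁ : ℝ → T3 → ℝ} {u u₁ : ℝ → T3 → V3} {ζ : ℝ → ℝ} {J : Set ℝ},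
    IsHardSphereEulerSolution σ T ρ u θ → IsHardSphereEulerSolution σ₁ T ρ₁ u₁ θ₁ → IsOpen J →
    ContDiffOn ℝ (⊤ : ℕ∞) ζ J → (∀ t ∈ Ico 0 T, ∀ x, ρ t x ∈ J) →
    Torus.IsSmoothSpaceTimeOn (Ico 0 T) (fun s x => ∑ i : Fin 3, ∑ l : Fin 3, 1 / 2 *
      (shadowWeightA ζ ρ θ s x *
          (Torus.partialDeriv i (Torus.partialDeriv l (fun y => ρ s y - ρ₁ s y)) x) ^ 2 +
        ρ s x * ‖Torus.partialDeriv i (Torus.partialDeriv l (fun y => u s y - u₁ s y)) x‖ ^ 2 +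
        shadowWeightB ρ θ s x *
          (Torus.partialDeriv i (Torus.partialDeriv l (fun y => θ s y - θ₁ s y)) x) ^ 2)) :=
  fun hE hE₁ hJ hζ hρJ => isSmoothSpaceTimeOn_shadowDensity2 hE hE₁ hJ hζ hρJ

/-- **Level 3, integrand of `shadowE3`** (literally its body): jointly smooth on `[0, T) × 𝕋³`.
[folklore] -/
theorem isSmoothSpaceTimeOn_shadowE3_integrand :
    ∀ {σ σ₁ T : ℝ} {ρ θ ρ₁ θ₁ : ℝ → T3 → ℝ} {u u₁ : ℝ → T3 → V3} {ζ : ℝ → ℝ} {J : Set ℝ},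
    IsHardSphereEulerSolution σ T ρ u θ → IsHardSphereEulerSolution σ₁ T ρ₁ u₁ θ₁ → IsOpen J →
    ContDiffOn ℝ (⊤ : ℕ∞) ζ J → (∀ t ∈ Ico 0 T, ∀ x, ρ t x ∈ J) →
    Torus.IsSmoothSpaceTimeOn (Ico 0 T) (fun s x => ∑ j : Fin 3, ∑ i : Fin 3, ∑ l : Fin 3, 1 / 2 *
      (shadowWeightA ζ ρ θ s x *
          (Torus.partialDeriv j (Torus.partialDeriv i (Torus.partialDeriv l
            (fun y => ρ s y - ρ₁ s y))) x) ^ 2 +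
        ρ s x * ‖Torus.partialDeriv j (Torus.partialDeriv i (Torus.partialDeriv l
            (fun y => u s y - u₁ s y))) x‖ ^ 2 +
        shadowWeightB ρ θ s x *
          (Torus.partialDeriv j (Torus.partialDeriv i (Torus.partialDeriv l
            (fun y => θ s y - θ₁ s y))) x) ^ 2)) :=
  fun hE hE₁ hJ hζ hρJ => isSmoothSpaceTimeOn_shadowDensity3 hE hE₁ hJ hζ hρJ

end Vocabulary

/-! ### Continuity in time of the level energies -/

section Energies

/-- **Level 0, named energy.** `s ↦ shadowE0 … s = ∫ e₀(s, x) dx` is continuous on `[0, T)`.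
[folklore] -/
theorem continuousOn_shadowE0 :
    ∀ {σ σ₁ T : ℝ} {ρ θ ρ₁ θ₁ : ℝ → T3 → ℝ} {u u₁ : ℝ → T3 → V3} {ζ : ℝ → ℝ} {J : Set ℝ},
    IsHardSphereEulerSolution σ T ρ u θ → IsHardSphereEulerSolution σ₁ T ρ₁ u₁ θ₁ → IsOpen J →
    ContDiffOn ℝ (⊤ : ℕ∞) ζ J → (∀ t ∈ Ico 0 T, ∀ x, ρ t x ∈ J) →
    ContinuousOn (shadowE0 ζ ρ θ u ρ₁ θ₁ u₁) (Ico 0 T) :=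
  fun hE hE₁ hJ hζ hρJ =>
    (isSmoothSpaceTimeOn_shadowE0_integrand hE hE₁ hJ hζ hρJ).continuousOn_integral (convex_Ico _ _)

/-- **Level 1, named energy.** `s ↦ shadowE1 … s = ∫ e₁(s, x) dx` is continuous on `[0, T)`.
[folklore] -/
theorem continuousOn_shadowE1 :
    ∀ {σ σ₁ T : ℝ} {ρ θ ρ₁ θ₁ : ℝ → T3 → ℝ} {u u₁ : ℝ → T3 → V3} {ζ : ℝ → ℝ} {J : Set ℝ},
    IsHardSphereEulerSolution σ T ρ u θ → IsHardSphereEulerSolution σ₁ T ρ₁ u₁ θ₁ → IsOpen J →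
    ContDiffOn ℝ (⊤ : ℕ∞) ζ J → (∀ t ∈ Ico 0 T, ∀ x, ρ t x ∈ J) →
    ContinuousOn (shadowE1 ζ ρ θ u ρ₁ θ₁ u₁) (Ico 0 T) :=
  fun hE hE₁ hJ hζ hρJ =>
    (isSmoothSpaceTimeOn_shadowE1_integrand hE hE₁ hJ hζ hρJ).continuousOn_integral (convex_Ico _ _)

/-- **Level 2, named energy.** `s ↦ shadowE2 … s = ∫ e₂(s, x) dx` is continuous on `[0, T)`.
[folklore] -/
theorem continuousOn_shadowE2 :
    ∀ {σ σ₁ T : ℝ} {ρ θ ρ₁ θ₁ : ℝ → T3 → ℝ} {u u₁ : ℝ → T3 → V3} {ζ : ℝ → ℝ} {J : Set ℝ},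
    IsHardSphereEulerSolution σ T ρ u θ → IsHardSphereEulerSolution σ₁ T ρ₁ u₁ θ₁ → IsOpen J →
    ContDiffOn ℝ (⊤ : ℕ∞) ζ J → (∀ t ∈ Ico 0 T, ∀ x, ρ t x ∈ J) →
    ContinuousOn (shadowE2 ζ ρ θ u ρ₁ θ₁ u₁) (Ico 0 T) :=
  fun hE hE₁ hJ hζ hρJ =>
    (isSmoothSpaceTimeOn_shadowE2_integrand hE hE₁ hJ hζ hρJ).continuousOn_integral (convex_Ico _ _)

/-- **Level 3, named energy.** `s ↦ shadowE3 … s = ∫ e₃(s, x) dx` is continuous on `[0, T)`.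
[folklore] -/
theorem continuousOn_shadowE3 :
    ∀ {σ σ₁ T : ℝ} {ρ θ ρ₁ θ₁ : ℝ → T3 → ℝ} {u u₁ : ℝ → T3 → V3} {ζ : ℝ → ℝ} {J : Set ℝ},
    IsHardSphereEulerSolution σ T ρ u θ → IsHardSphereEulerSolution σ₁ T ρ₁ u₁ θ₁ → IsOpen J →
    ContDiffOn ℝ (⊤ : ℕ∞) ζ J → (∀ t ∈ Ico 0 T, ∀ x, ρ t x ∈ J) →
    ContinuousOn (shadowE3 ζ ρ θ u ρ₁ θ₁ u₁) (Ico 0 T) :=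
  fun hE hE₁ hJ hζ hρJ =>
    (isSmoothSpaceTimeOn_shadowE3_integrand hE hE₁ hJ hζ hρJ).continuousOn_integral (convex_Ico _ _)

end Energies

/-! ### Continuity in time of sup norms -/

section Sup

/-- Pointwise bounds give sup-norm bounds: `‖f x‖ ≤ M` for all `x` (`M ≥ 0`) implies
`(eSupNorm f).toReal ≤ M`. [folklore] -/
theorem toReal_eSupNorm_le_of_forall_norm_le {X F : Type*} [NormedAddCommGroup F] {f : X → F}
    {M : ℝ} (hM : 0 ≤ M) (h : ∀ x, ‖f x‖ ≤ M) : (eSupNorm f).toReal ≤ M :=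
  ENNReal.toReal_le_of_le_ofReal hM (iSup_le fun x => by
    rw [← ofReal_norm]
    exact ENNReal.ofReal_le_ofReal (h x))

/-- **Sup-in-time continuity, scalar fields.** For a jointly smooth scalar field `φ` on
`[0, T) × 𝕋³`, the sup norm `g(s) = ‖φ s‖_∞ = (eSupNorm (φ s)).toReal` is continuous on `[0, T)`
(tube lemma over the compact torus; `Torus.IsSmoothSpaceTimeOn.continuousOn_toReal_eSupNorm`),
dominates `|φ s x|` for `s ∈ [0, T)` (`Torus.norm_le_toReal_eSupNorm`), and is the LEAST such
bound: `|φ s x| ≤ M` for all `x` (`M ≥ 0`) gives `g(s) ≤ M`. [folklore] -/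
theorem shadow_sup_continuous :
    ∀ {T : ℝ} {φ : ℝ → T3 → ℝ}, Torus.IsSmoothSpaceTimeOn (Ico 0 T) φ →
    ContinuousOn (fun s => (eSupNorm (φ s)).toReal) (Ico 0 T) ∧
      (∀ s ∈ Ico 0 T, ∀ x, |φ s x| ≤ (eSupNorm (φ s)).toReal) ∧
      ∀ (s M : ℝ), 0 ≤ M → (∀ x, |φ s x| ≤ M) → (eSupNorm (φ s)).toReal ≤ M := by
  intro T φ hφ
  refine ⟨hφ.continuousOn_toReal_eSupNorm, fun s hs x => ?_, fun s M hM h => ?_⟩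
  · rw [← Real.norm_eq_abs]
    exact Torus.norm_le_toReal_eSupNorm (hφ.isSmooth_slice hs).continuous x
  · exact toReal_eSupNorm_le_of_forall_norm_le hM fun x => (Real.norm_eq_abs _).trans_le (h x)

/-- **Sup-in-time continuity, vector fields.** For a jointly smooth `V3`-valued field `w` on
`[0, T) × 𝕋³`, the sup norm `g(s) = ‖w s‖_∞ = (eSupNorm (w s)).toReal` is continuous on `[0, T)`,
dominates `‖w s x‖` for `s ∈ [0, T)`, and `‖w s x‖ ≤ M` for all `x` (`M ≥ 0`) gives `g(s) ≤ M`.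
[folklore] -/
theorem shadow_sup_continuous_vec :
    ∀ {T : ℝ} {w : ℝ → T3 → V3}, Torus.IsSmoothSpaceTimeOn (Ico 0 T) w →
    ContinuousOn (fun s => (eSupNorm (w s)).toReal) (Ico 0 T) ∧
      (∀ s ∈ Ico 0 T, ∀ x, ‖w s x‖ ≤ (eSupNorm (w s)).toReal) ∧
      ∀ (s M : ℝ), 0 ≤ M → (∀ x, ‖w s x‖ ≤ M) → (eSupNorm (w s)).toReal ≤ M := by
  intro T w hw
  exact ⟨hw.continuousOn_toReal_eSupNorm, fun s hs x =>
    Torus.norm_le_toReal_eSupNorm (hw.isSmooth_slice hs).continuous x, fun s M hM h =>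
    toReal_eSupNorm_le_of_forall_norm_le hM h⟩

end Sup

end Summit.AtomisticToContinuum.HydrodynamicLimit.Theorems

end
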